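import Summits.CriticalPhenomena.PercolationContinuityZ3.Theorems.SahiMasterFamilyPhiFreeIndex
import Summits.CriticalPhenomena.PercolationContinuityZ3.Theorems.SahiMasterFamilyPhiVertex

/-!
# Single-label PATCHWORKS of two union-closed families are Sahi-nonnegative, every order
# (the outermost layers `N_1`, `N_{k-1}` of the Bernstein-positivity conjecture (B))

Unit `prim-masterthm-p4` (gen 21; crux anchor stmt-CriticalPhenomena-4575, helper work; memo
`run/shared/lean/prim/prim-masterthm/prim-masterthm-p4/P4-GEN21-REPORT.md` §3).  Companion of `…PhiFreeIndex` (one free index: only the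
restriction OFF an index has to be quotient-positive) and of the patchwork decomposition / conjecture (B) (`…UCBernstein`, proposed):
`Φ_{k+1}(w·1_𝒰 + (1−w)·1_𝒱) = Σ_{L ⊆ [k+1]} w^{k+1−|L|}(1−w)^{|L|} · Φ_{k+1}(1_{ℱ_L})` with the PATCHWORK families
`ℱ_L = {S : S ∈ 𝒱 if min S ∈ L, S ∈ 𝒰 otherwise}`, and (B) asserts that every layer sum `N_s = Σ_{|L|=s} Φ(1_{ℱ_L})` is `≥ 0`
(`N_0 = Φ(1_𝒰)`, `N_{k+1} = Φ(1_𝒱)` are the vertex theorem (V)).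

**THEOREM (every order)** `phiSet_patchSingle_nonneg`: for union-closed `𝒰, 𝒱 ∋ univ` and ANY element `v`, the single-label patchwork
`ℱ_{{v}} = {S : min S = v → S ∈ 𝒱;  min S ≠ v → S ∈ 𝒰}` has `Φ_{k+1}(1_{ℱ_{{v}}}) ≥ 0`.  Hence (memo §3) the layers `N_1` and, by the symmetry
`𝒰 ↔ 𝒱`, `N_k` of (B) are nonnegative for EVERY pair and every order — TERMWISE (whereas from `|L| = 2` on single patchworks can be negative,
e.g. on 4 points, and only the layer sums are conjectured nonnegative).  PROOF: the sets avoiding `v` are tested against `𝒰` alone, so the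
restriction of `1_{ℱ_{{v}}}` off the index `v` is the indicator of a union-closed family, which is min-closed, hence quotient-positive
(`PhiCylinder.qp_of_minClosed`); the values on the sets containing `v` are irrelevant to `PhiFreeIndex.phiSet_nonneg_of_qp_off`.
HONEST FRAMING: two layers of (B) for every order; (B), `UCHullNonneg k` (k ≥ 8), Sahi's `C_k` and the master theorem remain OPEN.
Axioms standard. [this work]
-/

noncomputable section

open scoped Classical

namespace Summit.CriticalPhenomena.PercolationContinuityZ3.Theorems

namespace PatchSingle

open Finset Function
open Literature.Combinatorics.Sahi2008
open PrincipalCapBeta (phiSet)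

variable {k : ℕ}

/-- The single-label patchwork indicator (sets rooted at `v` — `v` their least element — tested against `𝒱`, all others against `𝒰`)
equals the indicator of `𝒰` on every set avoiding `v`. [this work] -/
theorem patch_of_not_mem (𝒰 𝒱 : Finset (Finset (Fin (k + 1)))) {v : Fin (k + 1)} {S : Finset (Fin (k + 1))} (hv : v ∉ S) :
    (if (v ∈ S ∧ ∀ i ∈ S, v ≤ i) then (if S ∈ 𝒱 then (1 : ℝ) else 0) else (if S ∈ 𝒰 then (1 : ℝ) else 0)) =
      if S ∈ 𝒰 then (1 : ℝ) else 0 := by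
  rw [if_neg (fun h : (v ∈ S ∧ ∀ i ∈ S, v ≤ i) => hv h.1)]

/-- The image of a set of `Fin k` under `castSucc` followed by the transposition `(v last)` avoids `v`. [folklore] -/
theorem not_mem_image_swap (v : Fin (k + 1)) (T : Finset (Fin k)) :
    v ∉ (T.map Fin.castSuccEmb).map (Equiv.swap v (Fin.last k)).toEmbedding := by
  intro h
  rw [mem_map] at h
  obtain ⟨y, hy, hyv⟩ := h
  have hy' : y = Fin.last k := by
    have e1 : (Equiv.swap v (Fin.last k)) y = v := hyv
    have e2 := congrArg (Equiv.swap v (Fin.last k)) e1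
    rw [Equiv.swap_apply_self, Equiv.swap_apply_left] at e2
    exact e2
  rw [mem_map] at hy
  obtain ⟨x, _, hx⟩ := hy
  exact Fin.castSucc_ne_last x (hx.trans hy')

/-- **Single-label patchworks are Sahi-nonnegative, every order.**  For union-closed `𝒰 ∋ univ`, any family `𝒱 ∋ univ` and any `v`,
`Φ_{k+1}(1_{ℱ_{{v}}}) ≥ 0` where `ℱ_{{v}}` tests the sets rooted at `v` (least element `v`) against `𝒱` and all other sets against `𝒰`
(no hypothesis on `𝒱` beyond `univ ∈ 𝒱` is needed). [this work] -/
theorem phiSet_patchSingle_nonneg (𝒰 𝒱 : Finset (Finset (Fin (k + 1))))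
    (hU : ∀ A ∈ 𝒰, ∀ B ∈ 𝒰, A ∪ B ∈ 𝒰) (hUtop : univ ∈ 𝒰) (hVtop : univ ∈ 𝒱) (v : Fin (k + 1)) :
    0 ≤ phiSet (k + 1) (fun S => if (v ∈ S ∧ ∀ i ∈ S, v ≤ i) then (if S ∈ 𝒱 then (1 : ℝ) else 0)
      else (if S ∈ 𝒰 then (1 : ℝ) else 0)) := by
  set P : Finset (Fin (k + 1)) → ℝ := fun S => if (v ∈ S ∧ ∀ i ∈ S, v ≤ i) then (if S ∈ 𝒱 then (1 : ℝ) else 0)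
      else (if S ∈ 𝒰 then (1 : ℝ) else 0) with hP
  have hP1 : ∀ S, P S ≤ 1 := fun S => by simp only [hP]; split_ifs <;> norm_num
  have hP0 : ∀ S, 0 ≤ P S := fun S => by simp only [hP]; split_ifs <;> norm_num
  have huniv : P univ = 1 := by
    simp only [hP]
    by_cases h : (v ∈ (univ : Finset (Fin (k + 1))) ∧ ∀ i ∈ (univ : Finset (Fin (k + 1))), v ≤ i)
    · rw [if_pos h, if_pos hVtop]
    · rw [if_neg h, if_pos hUtop]
  refine PhiFreeIndex.phiSet_nonneg_of_qp_off P hP1 huniv v ?_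
  -- off `v` the patchwork is the union-closed family `𝒰`, pulled back along an injection: min-closed, hence quotient-positive
  set γ : Finset (Fin k) → ℝ :=
    fun T => P ((T.map Fin.castSuccEmb).map (Equiv.swap v (Fin.last k)).toEmbedding) with hγ
  have hγU : ∀ T, γ T = if (T.map Fin.castSuccEmb).map (Equiv.swap v (Fin.last k)).toEmbedding ∈ 𝒰 then 1 else 0 :=
    fun T => patch_of_not_mem 𝒰 𝒱 (not_mem_image_swap v T)
  have hmin : ∀ S T, min (γ S) (γ T) ≤ γ (S ∪ T) := by
    intro S T
    rw [hγU, hγU, hγU, Finset.map_union, Finset.map_union]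
    by_cases hS : (S.map Fin.castSuccEmb).map (Equiv.swap v (Fin.last k)).toEmbedding ∈ 𝒰
    · by_cases hT : (T.map Fin.castSuccEmb).map (Equiv.swap v (Fin.last k)).toEmbedding ∈ 𝒰
      · rw [if_pos hS, if_pos hT, if_pos (hU _ hS _ hT)]; simp
      · rw [if_neg hT]; split_ifs <;> simp
    · rw [if_neg hS]; split_ifs <;> simp
  exact PhiCylinder.qp_of_minClosed γ (fun T => hP0 _) (fun T => hP1 _) hmin

/-- The mirror statement (`𝒰` on the sets rooted at `v`, `𝒱` elsewhere; `𝒱` union-closed) — the layer `N_k` of (B). [this work] -/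
theorem phiSet_patchSingle_nonneg' (𝒰 𝒱 : Finset (Finset (Fin (k + 1))))
    (hV : ∀ A ∈ 𝒱, ∀ B ∈ 𝒱, A ∪ B ∈ 𝒱) (hUtop : univ ∈ 𝒰) (hVtop : univ ∈ 𝒱) (v : Fin (k + 1)) :
    0 ≤ phiSet (k + 1) (fun S => if (v ∈ S ∧ ∀ i ∈ S, v ≤ i) then (if S ∈ 𝒰 then (1 : ℝ) else 0)
      else (if S ∈ 𝒱 then (1 : ℝ) else 0)) :=
  phiSet_patchSingle_nonneg 𝒱 𝒰 hV hVtop hUtop v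

/-- **The layer `N_1 = Σ_v Φ(1_{ℱ_{{v}}})` of conjecture (B) is nonnegative for every pair and every order.** [this work] -/
theorem layer_one_nonneg (𝒰 𝒱 : Finset (Finset (Fin (k + 1))))
    (hU : ∀ A ∈ 𝒰, ∀ B ∈ 𝒰, A ∪ B ∈ 𝒰) (hUtop : univ ∈ 𝒰) (hVtop : univ ∈ 𝒱) :
    0 ≤ ∑ v : Fin (k + 1), phiSet (k + 1) (fun S => if (v ∈ S ∧ ∀ i ∈ S, v ≤ i) then (if S ∈ 𝒱 then (1 : ℝ) else 0)
      else (if S ∈ 𝒰 then (1 : ℝ) else 0)) :=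
  sum_nonneg fun v _ => phiSet_patchSingle_nonneg 𝒰 𝒱 hU hUtop hVtop v

end PatchSingle

end Summit.CriticalPhenomena.PercolationContinuityZ3.Theorems
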